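/-
Copyright: statement-level skeleton of a published paper (lit-balaban cell, Phase-2 proof seat p10, gen 5). No proof claims
beyond what the kernel checks below.
-/
import Mathlib
import Literature.MathematicalPhysics.QuantumFieldTheory.BalabanImbrieJaffe1984to88.BIJ85FibreOffCentre
import Literature.MathematicalPhysics.QuantumFieldTheory.BalabanImbrieJaffe1984to88.BIJ85SigmaOnCurls325

/-!
# `BalabanImbrieJaffe1984to88.BIJ85Thm711AllLMultiplier` — T. Bałaban, J. Imbrie, A. Jaffe, *Renormalization of the Higgs model:
minimizers, propagators and the stability of mean field theory*, Commun. Math. Phys. **97** (1985) 299–329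
[BalabanImbrieJaffe1985]: Sect. 7.1 pp. 323–325, (7.1.15)/(7.1.19)/(7.1.29)/(7.1.31) — **the τ₂-multiplier of the curl part and
the (7.1.19) splitting at the fibre, for EVERY block size n** (file 4a of seat p10 gen 5's all-n chain `BIJ85FibreDuality`/
`BIJ85FibreDualBound` → `BIJ85FibreCurlIntertwine` → `BIJ85FibreOffCentre` → (`BIJ85FibreCrossTerms`, this) → `BIJ85Thm711AllL`):
the constants ε₁(d), δ(d), c(d) = `cAllL d` of the all-n Theorem 7.1.1; the splitting φ = ∂^{(1)}(p′)B + f^⊥ of an antisymmetric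
fibre two-form with CO-CLOSED central source of f^⊥ (`decomp_allL`, from gen 2's `BIJ85CurlComplement719`); and the multiplier
Λ = δ·conj(P(DB))⊙φ^{−1/2} (`lamK`) with its four identities/bounds — admissibility Σ∂^{(1)}_νΛ_ν = 0, pairing ΣΛ_νB_ν = δQ(B),
Σφ_ν|Λ_ν|² = δ²Q(B), Cauchy–Schwarz for ΣΛ_νA_ν, and Q(B) ≥ ε₁Σ|(∂^{(1)}B)_{μν}|² (gen 2's `normSq_projK_mulVec` + `lower_bound_eps`
with the all-n sandwich `BIJ85FibreOffCentre.phiK_sandwich`)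

statement-level skeleton of published theorems with citation tags; proofs where landed; nothing here is a claim about
the Yang–Mills mass gap

PDF held: `paper:balaban1985-cmp97-bij-higgs-minimizers` (journal page = PDF page + 298).  Renders read as images: PDF pp.
25–27 (journal 323–325), `run/shared/lean/pub/pub-balaban/t4/b2b-balaban-t4-lit2/renders/bij1985/…-p025…p027-x2.png`.

CITATION HEADER (lean-in-tree rule).  Part of the lit-balaban TYPED SKELETON (HOME `run/shared/lean/pub/lit-balaban/`); WHAT IS
REPRODUCED: the (7.1.19)/(7.1.31) steps of the printed proof of **C1.Thm7.1.1** (fold owner r15, `HOME/lit-balaban-r15/ROWS-C1.md`)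
for all n.  THE PRINTED TEXT (p. 323 [PDF 25]): *"Write the two-forms 𝒦(p) as a sum of curls and an orthogonal complement, 𝒦(p) =
∂ℋ(p) + (∂ℋ(p))^⊥. (7.1.19a)"*; (p. 325 [PDF 27]): *"since … f^⊥ is defined with respect to the inner product (7.1.19b), … the ∂
terms vanish … ⟨∂B, τ₂∂B⟩ = ⟨B, Δ_kB⟩ (7.1.31) … which is bounded below by ε‖∂B‖² (see also [6I, 8])"*.  In the dual formulation
(`BIJ85FibreDuality`) τ₂ enters through a MULTIPLIER Λ of the constraint; the bracket P of (7.1.15) (gen 2's `projK`, a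
self-adjoint idempotent) and the rescaling D = diag(φ_ν^{−1/2}) (`scl`/`sqrtInv`) are reused verbatim.
WHAT IS KERNEL-CHECKED (zero `sorry`, standard axioms): `epsOne`, `deltaC`, **`cAllL`**, `epsOne_pos`, `deltaC_pos`, `deltaC_le_one`,
`cAllL_pos`, `cAllL_le`; **`decomp_allL`**; `lamK`, `qK`, `qK_nonneg`, `enn_pos`, **`lamK_orth`**,
**`lamK_pair_B`**, **`sum_phiK_norm_lamK_sq`**, **`norm_lamK_pair_sq_le`**, **`qK_ge`**.  NOT CLAIMED here: the assembly
(`BIJ85Thm711AllL`).  Unit `lit-balaban-p10` (gen 5), HOME as above.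
-/

namespace Literature.MathematicalPhysics.QuantumFieldTheory.BalabanImbrieJaffe1984to88.BIJ85Thm711AllLMultiplier

open scoped BigOperators ComplexConjugate Matrix
open Complex Finset
open Literature.MathematicalPhysics.QuantumFieldTheory.Balaban1983to89
open Literature.MathematicalPhysics.QuantumFieldTheory.Balaban1983to89.B5Prop11Plancherel
open Literature.MathematicalPhysics.QuantumFieldTheory.Balaban1983to89.B5Prop11Fiber
open Literature.MathematicalPhysics.QuantumFieldTheory.Balaban1983to89.B5Block118
open Literature.MathematicalPhysics.QuantumFieldTheory.BalabanImbrieJaffe1984to88.BIJ85Eq715ConfigSymbols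
open Literature.MathematicalPhysics.QuantumFieldTheory.BalabanImbrieJaffe1984to88.BIJ85Eq7111EdgeAverage
open Literature.MathematicalPhysics.QuantumFieldTheory.BalabanImbrieJaffe1984to88.BIJ85Eq7111EdgeAdjoint
open Literature.MathematicalPhysics.QuantumFieldTheory.BalabanImbrieJaffe1984to88.BIJ85Eq7112FibreEnergy
open Literature.MathematicalPhysics.QuantumFieldTheory.BalabanImbrieJaffe1984to88.BIJ85FibreDuality
open Literature.MathematicalPhysics.QuantumFieldTheory.BalabanImbrieJaffe1984to88.BIJ85FibreCurlIntertwine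
open Literature.MathematicalPhysics.QuantumFieldTheory.BalabanImbrieJaffe1984to88.BIJ85FibreOffCentre
open Literature.MathematicalPhysics.QuantumFieldTheory.BalabanImbrieJaffe1984to88.BIJ85CurlComplement719
  (IsTwoForm curlP PerpCurl projK gOf exists_decomp719_twoForm div_eq_zero_of_perp projK_conjTranspose projK_mul_projK)
open Literature.MathematicalPhysics.QuantumFieldTheory.BalabanImbrieJaffe1984to88.BIJ85Tau2Kernel715
  (enn sqrtInv scl norm_sqrtInv_sq sum_norm_scl_sq projK_mulVec_self normSq_projK_mulVec norm_scl_curl_sq)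
open Literature.MathematicalPhysics.QuantumFieldTheory.BalabanImbrieJaffe1984to88.BIJ85SigmaOnCurls325 (lower_bound_eps)

noncomputable section

variable {d : ℕ}

/-! ## §0 The constants ε₁(d), δ(d), c(d) -/

/-- ε₁(d) = (4/π²)^{d+2}/2: the constant of *"bounded below by ε‖∂B‖²"* (p. 325) delivered by the [6I]-type sandwich
(4/π²)^{d+2} ≤ Δ^{(1)}φ_ν ≤ 1 (`BIJ85FibreOffCentre.phiK_sandwich`) in `lower_bound_eps`. [cite: BalabanImbrieJaffe1985, (7.1.31) p.325] -/
def epsOne (d : ℕ) : ℝ := (4 / Real.pi ^ 2) ^ (d + 2) / 2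

/-- δ(d) = min(1, (4/π²)^d/(4C₅(d)²)) with C₅(d)² = (33/2)²·d/φ_min(d) (= `BIJ85FibreCrossTerms.cFiveSq d`, by `rfl`): the weight of
the τ₂-multiplier, small enough for the τ₀ bound (4/π²)^d‖f^⊥‖² to absorb the cross term 2δC₅²‖f^⊥‖² of (7.1.23)–(7.1.24).
[cite: BalabanImbrieJaffe1985, (7.1.27) p.324] -/
def deltaC (d : ℕ) : ℝ := min 1 ((4 / Real.pi ^ 2) ^ d / (4 * ((33 / 2) ^ 2 * d / phiMin d)))

/-- **The constant of Theorem 7.1.1 for every block size**: c(d) = ¼·min((4/π²)^d, δ(d)ε₁(d)) — independent of n = L^k, of the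
torus and of the fields. [cite: BalabanImbrieJaffe1985, Theorem 7.1.1 p.321] -/
def cAllL (d : ℕ) : ℝ := 1 / 4 * min ((4 / Real.pi ^ 2) ^ d) (deltaC d * epsOne d)

/-- ε₁(d) > 0. [cite: BalabanImbrieJaffe1985, (7.1.31) p.325] -/
theorem epsOne_pos : 0 < epsOne d := by
  unfold epsOne
  positivity

/-- 0 < δ(d) (d ≥ 1). [cite: BalabanImbrieJaffe1985, (7.1.27) p.324] -/
theorem deltaC_pos (hd : 0 < d) : 0 < deltaC d := by
  unfold deltaC
  have := phiMin_pos hd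
  have : (0 : ℝ) < d := by exact_mod_cast hd
  exact lt_min one_pos (by positivity)

/-- δ(d) ≤ 1. [cite: BalabanImbrieJaffe1985, (7.1.27) p.324] -/
theorem deltaC_le_one : deltaC d ≤ 1 := min_le_left _ _

/-- **c(d) > 0** for d ≥ 1. [cite: BalabanImbrieJaffe1985, Theorem 7.1.1 p.321] -/
theorem cAllL_pos (hd : 0 < d) : 0 < cAllL d := by
  unfold cAllL
  exact mul_pos (by norm_num) (lt_min (by positivity) (mul_pos (deltaC_pos hd) epsOne_pos))

/-- c(d) ≤ (4/π²)^d (the p′ = 0 fibre needs only the τ₀-type bound). [cite: BalabanImbrieJaffe1985, (7.1.20) p.323] -/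
theorem cAllL_le : cAllL d ≤ (4 / Real.pi ^ 2) ^ d := by
  unfold cAllL
  have h := min_le_left ((4 / Real.pi ^ 2) ^ d) (deltaC d * epsOne d)
  have h0 : (0 : ℝ) ≤ (4 / Real.pi ^ 2) ^ d := by positivity
  linarith

/-! ## §1 Kernel lemmas -/

/-- kernel: for the self-adjoint idempotent bracket P of (7.1.14)/(7.1.15), Σ_i conj((Py)_i)·y_i = ‖Py‖². [folklore] -/
private theorem proj_pair (e y : Fin d → ℂ) :
    ∑ i, conj ((projK e *ᵥ y) i) * y i = ((∑ i, ‖(projK e *ᵥ y) i‖ ^ 2 : ℝ) : ℂ) := by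
  have hL : ∑ i, conj ((projK e *ᵥ y) i) * y i = star (projK e *ᵥ y) ⬝ᵥ y := rfl
  have h1 : star (projK e *ᵥ y) ⬝ᵥ y = star y ⬝ᵥ (projK e *ᵥ y) := by
    rw [Matrix.star_mulVec, projK_conjTranspose, ← Matrix.dotProduct_mulVec]
  have h2 : star (projK e *ᵥ y) ⬝ᵥ (projK e *ᵥ y) = star y ⬝ᵥ (projK e *ᵥ y) := by
    rw [Matrix.star_mulVec, projK_conjTranspose, ← Matrix.dotProduct_mulVec, Matrix.mulVec_mulVec, projK_mul_projK]
  rw [hL, h1, ← h2]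
  simp only [dotProduct, Pi.star_apply, Complex.star_def, Complex.conj_mul']
  push_cast
  rfl

/-- kernel: the rescaling entrywise. [folklore] -/
private theorem scl_apply (φ : Fin d → ℝ) (x : Fin d → ℂ) (ν : Fin d) : scl φ x ν = sqrtInv φ ν * x ν := rfl

section Fibre

variable (n : ℕ) [NeZero n] (M : Fin d → ℕ) [hM : ∀ μ, NeZero (M μ)]

/-! ## §2 (7.1.19) at the fibre: φ = ∂^{(1)}B + f^⊥ with CO-CLOSED central source of f^⊥ -/

/-- **(7.1.19) + (7.1.29) at the unit momentum p′, every n**: an antisymmetric φ splits as `φ = ∂^{(1)}(p′)B + ψ` with ψ antisymmetric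
and `Σ_μ ∂̄_μ(p′)·(w̄_{μν}(p′)ψ_{μν}) = 0` — the central source of the (∂ℋ)^⊥ part (orthogonality for the product (7.1.19b) with the
eigenvalues v_μ(p′), which never vanish) is co-closed, *"the ∂ terms vanish"* (p. 325). [cite: BalabanImbrieJaffe1985, (7.1.19) p.323] -/
theorem decomp_allL (q : Tor M) {φ : Fin d × Fin d → ℂ} (hφ : ∀ μ ν, φ (ν, μ) = -φ (μ, ν)) :
    ∃ (B : Fin d → ℂ) (ψ : Fin d × Fin d → ℂ), φ = curl1 M q B + ψ ∧ (∀ μ ν, ψ (ν, μ) = -ψ (μ, ν)) ∧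
      ∀ ν, divK n M q ψ 0 ν = 0 := by
  have hn1 : 1 ≤ n := NeZero.one_le
  have hv : ∀ μ, vSym n 0 (sOf M q) μ ≠ 0 := fun μ h => by
    have h4 := norm_vSym_zero_sq_ge n M q μ
    rw [h, norm_zero, zero_pow two_ne_zero] at h4
    exact absurd h4 (not_le.mpr (by positivity))
  obtain ⟨B, g, hfg, hperp, hg⟩ := exists_decomp719_twoForm
    (fun μ => vSym n 0 (sOf M q) μ * dSym n 0 (sOf M q) μ) (vSym n 0 (sOf M q)) (f := fun μ ν => φ (μ, ν)) hφ
  refine ⟨B, fun a => g a.1 a.2, ?_, fun μ ν => hg μ ν, fun ν => ?_⟩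
  · funext a
    obtain ⟨μ, ν⟩ := a
    have h := congrFun (congrFun hfg μ) ν
    simp only [Pi.add_apply] at h ⊢
    rw [h]
    simp only [curlP, curl1, d1Sym_eq_vSym_mul n hn1 0 (sOf M q)]
  · have hd0 := div_eq_zero_of_perp (e := dSym n 0 (sOf M q)) hg hv hperp ν
    unfold divK srcK
    calc ∑ μ, conj (dSym n 0 (sOf M q) μ) * (conj (edgeW n 0 (sOf M q) μ ν) * (fun a : Fin d × Fin d => g a.1 a.2) (μ, ν))
        = conj (uSym n 0 (sOf M q)) * ∑ μ, conj (dSym n 0 (sOf M q) μ) * gOf (vSym n 0 (sOf M q)) g μ ν := by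
          rw [Finset.mul_sum]
          refine Finset.sum_congr rfl fun μ _ => ?_
          dsimp only
          by_cases hμν : μ = ν
          · subst hμν
            have h0 : g μ μ = 0 := by
              have := hg μ μ
              linear_combination (1 / 2 : ℂ) * this
            simp [gOf, h0]
          · rw [edgeW_eq_div n M 0 q hμν (hv μ) (hv ν)]
            simp only [gOf, map_div₀, map_mul, Complex.conj_conj]
            ring
      _ = 0 := by rw [hd0, mul_zero]

/-! ## §3 The τ₂-multiplier of the curl part -/

/-- The multiplier Λ = δ·conj(P(D B))⊙φ^{−1/2} attached to the curl part ∂^{(1)}B: D = diag(φ_ν^{−1/2}), P the bracket of (7.1.15)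
(projection off D∂^{(1)}), δ a weight. [cite: BalabanImbrieJaffe1985, (7.1.15) p.323] -/
def lamK (q : Tor M) (δ : ℝ) (B : Fin d → ℂ) (ν : Fin d) : ℂ :=
  (δ : ℂ) * conj ((projK (scl (phiK n M q) (d1Sym (sOf M q))) *ᵥ scl (phiK n M q) B) ν) * sqrtInv (phiK n M q) ν

/-- Q(B) = ‖P(D B)‖²: the τ₂-norm of the curl part, ⟨∂B, τ₂∂B⟩ in the normalisation of (7.1.15)/(7.1.31).
[cite: BalabanImbrieJaffe1985, (7.1.31) p.325] -/
def qK (q : Tor M) (B : Fin d → ℂ) : ℝ :=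
  ∑ i, ‖(projK (scl (phiK n M q) (d1Sym (sOf M q))) *ᵥ scl (phiK n M q) B) i‖ ^ 2

omit [NeZero n] hM in
/-- Q(B) ≥ 0. [cite: BalabanImbrieJaffe1985, (7.1.31) p.325] -/
theorem qK_nonneg (q : Tor M) (B : Fin d → ℂ) : 0 ≤ qK n M q B := by
  unfold qK
  exact Finset.sum_nonneg fun i _ => sq_nonneg _

/-- N = Σ_ρ|∂^{(1)}_ρ|²/φ_ρ > 0 for p′ ≠ 0 (d ≥ 1): indeed N ≥ (Δ^{(1)})² by Δ^{(1)}φ_ρ ≤ 1.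
[cite: BalabanImbrieJaffe1985, (7.1.15) p.323] -/
theorem enn_pos (hd : 0 < d) {q : Tor M} (hq : q ≠ 0) : 0 < enn (d1Sym (sOf M q)) (phiK n M q) := by
  have hε := epsSq_pos M hq
  have hterm : ∀ ρ, epsSq M q * ‖d1Sym (sOf M q) ρ‖ ^ 2 ≤ ‖d1Sym (sOf M q) ρ‖ ^ 2 / phiK n M q ρ := by
    intro ρ
    have hφ := phiK_pos n M hd hq ρ
    have hs := (phiK_sandwich n M hq ρ).2
    rw [le_div_iff₀ hφ]
    calc epsSq M q * ‖d1Sym (sOf M q) ρ‖ ^ 2 * phiK n M q ρ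
        = ‖d1Sym (sOf M q) ρ‖ ^ 2 * (epsSq M q * phiK n M q ρ) := by ring
      _ ≤ ‖d1Sym (sOf M q) ρ‖ ^ 2 * 1 := mul_le_mul_of_nonneg_left hs (sq_nonneg _)
      _ = ‖d1Sym (sOf M q) ρ‖ ^ 2 := mul_one _
  calc (0 : ℝ) < epsSq M q * epsSq M q := mul_pos hε hε
    _ = ∑ ρ, epsSq M q * ‖d1Sym (sOf M q) ρ‖ ^ 2 := by rw [← Finset.mul_sum]; rfl
    _ ≤ enn (d1Sym (sOf M q)) (phiK n M q) := by
        unfold enn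
        exact Finset.sum_le_sum fun ρ _ => hterm ρ

/-- **Λ is an admissible multiplier**: Σ_ν ∂^{(1)}_ν(p′)Λ_ν = 0 (P kills D∂^{(1)}; p′ ≠ 0).
[cite: BalabanImbrieJaffe1985, (7.1.15) p.323] -/
theorem lamK_orth (hd : 0 < d) {q : Tor M} (hq : q ≠ 0) (δ : ℝ) (B : Fin d → ℂ) :
    ∑ ν, d1Sym (sOf M q) ν * lamK n M q δ B ν = 0 := by
  have hφ : ∀ ν, 0 < phiK n M q ν := fun ν => phiK_pos n M hd hq ν
  have he : (∑ ρ, ‖scl (phiK n M q) (d1Sym (sOf M q)) ρ‖ ^ 2) ≠ 0 := by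
    rw [sum_norm_scl_sq hφ]
    exact (enn_pos n M hd hq).ne'
  have hP := projK_mulVec_self he
  have h1 : ∑ ν, d1Sym (sOf M q) ν * lamK n M q δ B ν
      = (δ : ℂ) * (star ((projK (scl (phiK n M q) (d1Sym (sOf M q)))) *ᵥ scl (phiK n M q) B)
          ⬝ᵥ scl (phiK n M q) (d1Sym (sOf M q))) := by
    rw [dotProduct, Finset.mul_sum]
    refine Finset.sum_congr rfl fun ν _ => ?_
    simp only [Pi.star_apply, Complex.star_def, scl_apply, lamK]
    ring
  rw [h1, Matrix.star_mulVec, projK_conjTranspose, ← Matrix.dotProduct_mulVec, hP, dotProduct_zero, mul_zero]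

omit [NeZero n] hM in
/-- **The multiplier pairs with B to δQ(B)**: Σ_ν Λ_νB_ν = δ‖P(D B)‖². [cite: BalabanImbrieJaffe1985, (7.1.31) p.325] -/
theorem lamK_pair_B (q : Tor M) (δ : ℝ) (B : Fin d → ℂ) :
    ∑ ν, lamK n M q δ B ν * B ν = ((δ * qK n M q B : ℝ) : ℂ) := by
  have h1 : ∑ ν, lamK n M q δ B ν * B ν
      = (δ : ℂ) * ∑ ν, conj (((projK (scl (phiK n M q) (d1Sym (sOf M q)))) *ᵥ scl (phiK n M q) B) ν)
          * scl (phiK n M q) B ν := by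
    rw [Finset.mul_sum]
    refine Finset.sum_congr rfl fun ν _ => ?_
    simp only [scl_apply, lamK]
    ring
  rw [h1, proj_pair, qK]
  push_cast
  ring

/-- Σ_ν φ_ν|Λ_ν|² = δ²Q(B) (p′ ≠ 0). [cite: BalabanImbrieJaffe1985, (7.1.10) p.322] -/
theorem sum_phiK_norm_lamK_sq (hd : 0 < d) {q : Tor M} (hq : q ≠ 0) {δ : ℝ} (hδ : 0 ≤ δ) (B : Fin d → ℂ) :
    ∑ ν, phiK n M q ν * ‖lamK n M q δ B ν‖ ^ 2 = δ ^ 2 * qK n M q B := by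
  have hφ : ∀ ν, 0 < phiK n M q ν := fun ν => phiK_pos n M hd hq ν
  rw [qK, Finset.mul_sum]
  refine Finset.sum_congr rfl fun ν _ => ?_
  have hφν := (hφ ν).ne'
  rw [lamK, norm_mul, norm_mul, Complex.norm_conj, Complex.norm_real, Real.norm_of_nonneg hδ, mul_pow, mul_pow,
    norm_sqrtInv_sq hφ ν]
  field_simp

/-- **Cauchy–Schwarz for the cross term**: |Σ_ν Λ_νA_ν|² ≤ δ²Q(B)·Σ_ν|A_ν|²/φ_ν (p′ ≠ 0). [cite: BalabanImbrieJaffe1985, (7.1.27) p.324] -/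
theorem norm_lamK_pair_sq_le (hd : 0 < d) {q : Tor M} (hq : q ≠ 0) {δ : ℝ} (hδ : 0 ≤ δ) (B : Fin d → ℂ) (A : Fin d → ℂ) :
    ‖∑ ν, lamK n M q δ B ν * A ν‖ ^ 2 ≤ δ ^ 2 * qK n M q B * ∑ ν, ‖A ν‖ ^ 2 / phiK n M q ν := by
  have hφ : ∀ ν, 0 < phiK n M q ν := fun ν => phiK_pos n M hd hq ν
  set y := (projK (scl (phiK n M q) (d1Sym (sOf M q)))) *ᵥ scl (phiK n M q) B with hy
  have h1 : ‖∑ ν, lamK n M q δ B ν * A ν‖ ≤ δ * ∑ ν, ‖y ν‖ * (‖sqrtInv (phiK n M q) ν‖ * ‖A ν‖) := by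
    calc ‖∑ ν, lamK n M q δ B ν * A ν‖ ≤ ∑ ν, ‖lamK n M q δ B ν * A ν‖ := norm_sum_le _ _
      _ = δ * ∑ ν, ‖y ν‖ * (‖sqrtInv (phiK n M q) ν‖ * ‖A ν‖) := by
          rw [Finset.mul_sum]
          refine Finset.sum_congr rfl fun ν _ => ?_
          rw [norm_mul, lamK, norm_mul, norm_mul, Complex.norm_conj, Complex.norm_real, Real.norm_of_nonneg hδ, ← hy]
          ring
  have h2 : (∑ ν, ‖y ν‖ * (‖sqrtInv (phiK n M q) ν‖ * ‖A ν‖)) ^ 2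
      ≤ (∑ ν, ‖y ν‖ ^ 2) * ∑ ν, (‖sqrtInv (phiK n M q) ν‖ * ‖A ν‖) ^ 2 :=
    Finset.sum_mul_sq_le_sq_mul_sq _ (fun ν => ‖y ν‖) (fun ν => ‖sqrtInv (phiK n M q) ν‖ * ‖A ν‖)
  have h3 : ∑ ν, (‖sqrtInv (phiK n M q) ν‖ * ‖A ν‖) ^ 2 = ∑ ν, ‖A ν‖ ^ 2 / phiK n M q ν :=
    Finset.sum_congr rfl fun ν _ => by rw [mul_pow, norm_sqrtInv_sq hφ ν, inv_mul_eq_div]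
  have h0 : 0 ≤ δ * ∑ ν, ‖y ν‖ * (‖sqrtInv (phiK n M q) ν‖ * ‖A ν‖) :=
    mul_nonneg hδ (Finset.sum_nonneg fun ν _ => by positivity)
  have hQ : qK n M q B = ∑ ν, ‖y ν‖ ^ 2 := by rw [qK, hy]
  calc ‖∑ ν, lamK n M q δ B ν * A ν‖ ^ 2 ≤ (δ * ∑ ν, ‖y ν‖ * (‖sqrtInv (phiK n M q) ν‖ * ‖A ν‖)) ^ 2 :=
        pow_le_pow_left₀ (norm_nonneg _) h1 2
    _ = δ ^ 2 * (∑ ν, ‖y ν‖ * (‖sqrtInv (phiK n M q) ν‖ * ‖A ν‖)) ^ 2 := mul_pow _ _ _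
    _ ≤ δ ^ 2 * ((∑ ν, ‖y ν‖ ^ 2) * ∑ ν, (‖sqrtInv (phiK n M q) ν‖ * ‖A ν‖) ^ 2) :=
        mul_le_mul_of_nonneg_left h2 (sq_nonneg _)
    _ = δ ^ 2 * qK n M q B * ∑ ν, ‖A ν‖ ^ 2 / phiK n M q ν := by rw [h3, hQ]; ring

/-- **Q(B) ≥ ε₁(d)·Σ_{μν}|(∂^{(1)}B)_{μν}|²** (p′ ≠ 0): ‖P(D B)‖² = ½N^{−1}Σ|(∂^{(1)}B)_{μν}|²/(φ_μφ_ν) (the Lagrange identity of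
gen 2's `normSq_projK_mulVec`) and the sandwich (4/π²)^{d+2} ≤ Δ^{(1)}φ_ν ≤ 1 — *"which is bounded below by ε‖∂B‖² (see also
[6I, 8])"*, every n. [cite: BalabanImbrieJaffe1985, (7.1.31) p.325] -/
theorem qK_ge (hd : 0 < d) {q : Tor M} (hq : q ≠ 0) (B : Fin d → ℂ) :
    epsOne d * ∑ μ, ∑ ν, ‖curl1 M q B (μ, ν)‖ ^ 2 ≤ qK n M q B := by
  have hφ : ∀ ν, 0 < phiK n M q ν := fun ν => phiK_pos n M hd hq ν
  have hε := epsSq_pos M hq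
  have he : (∑ ρ, ‖scl (phiK n M q) (d1Sym (sOf M q)) ρ‖ ^ 2) ≠ 0 := by
    rw [sum_norm_scl_sq hφ]
    exact (enn_pos n M hd hq).ne'
  have hQ : qK n M q B = 1 / 2 * (enn (d1Sym (sOf M q)) (phiK n M q))⁻¹
      * ∑ μ, ∑ ν, ‖curlP (d1Sym (sOf M q)) B μ ν‖ ^ 2 / (phiK n M q μ * phiK n M q ν) := by
    rw [qK, normSq_projK_mulVec he, sum_norm_scl_sq hφ]
    congr 1
    exact Finset.sum_congr rfl fun μ _ => Finset.sum_congr rfl fun ν _ => norm_scl_curl_sq hφ _ _ μ ν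
  have hlb := lower_bound_eps (e := d1Sym (sOf M q)) (φ := phiK n M q) (γm := (4 / Real.pi ^ 2) ^ (d + 2)) (γp := 1)
    (by positivity) hε (fun μ => phiK_sandwich n M hq μ) (curlP (d1Sym (sOf M q)) B)
  rw [one_pow, mul_one] at hlb
  rw [hQ]
  calc epsOne d * ∑ μ, ∑ ν, ‖curl1 M q B (μ, ν)‖ ^ 2
      = (4 / Real.pi ^ 2) ^ (d + 2) / 2 * ∑ μ, ∑ ν, ‖curlP (d1Sym (sOf M q)) B μ ν‖ ^ 2 := by rw [epsOne]; rfl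
    _ ≤ _ := hlb

end Fibre

end

end Literature.MathematicalPhysics.QuantumFieldTheory.BalabanImbrieJaffe1984to88.BIJ85Thm711AllLMultiplier
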